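import Literature.Analysis.FluidPDE.SelfSimilarEulerBernoulliMaximum
import Literature.Analysis.FluidPDE.SelfSimilarEulerBernoulliSuperlevel
import HarnessLib

/-!
# The Bernoulli cap of an in-window self-similar Euler profile is irrotational

Analysis/FluidPDE proofs file (theorems only), seventh (closing) part of the Eulerian treatment of
Constantin–Ignatova–Vicol 2026 (arXiv:2602.17570) §3.4.3–§3.5 for `C²` stationary self-similar
Euler profiles `(U, P)` in the window `0 < γ < ½` with the far-field bounds (3.8). Combining

* the LOCALISATION `curl_eq_zero_on_bernoulliSuperlevel_of_hasSelfSimilarFarField` (the vorticity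
  vanishes on `{ℋ > t}` as soon as every stagnation point `z` with `ℋ(z) ≥ t` has all strain
  eigenvalues `< 1`), and
* the BERNOULLI-TOP theorem `exists_bernoulliTop_stagnation` (the maximum of `ℋ` is attained at a
  stagnation point with `DV ≥ 0`, stretching `≤ 2γ|w|² < |w|²`),

with the compactness of the set of "bad" stagnation points (those carrying a unit vector `w` with
`⟪DU(z) w, w⟫ ≥ 1`), we obtain:

> **Theorem** (`IsSelfSimilarEulerProfile.exists_irrotational_bernoulliCap`). For `0 < γ < ½` and
> a `C²` profile with (3.8) there is a level `t` strictly below `max ℋ` such that `curl U ≡ 0` on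
> the (nonempty, open) Bernoulli cap `{ℋ > t}`; the cap contains the Bernoulli-top stagnation
> point. Being incompressible, `U` is harmonic there.

So the top of the Bernoulli landscape of a putative in-window self-similar collapse is potential
flow; all vorticity sits at and below the highest Bernoulli level of a stagnation point with a
unit stretching rate.

## References

* P. Constantin, M. Ignatova, V. Vicol, arXiv:2602.17570 (2026), §3.4.3–§3.5.
  [ConstantinIgnatovaVicol2026Putative]
-/

noncomputable section

open Set Filter Topology InnerProductSpace Metric
open scoped RealInnerProductSpace

namespace Literature.Analysis.FluidPDE

namespace IsSelfSimilarEulerProfile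

variable {γ : ℝ} {c : EuclideanSpace ℝ (Fin 3)}
  {U : EuclideanSpace ℝ (Fin 3) → EuclideanSpace ℝ (Fin 3)} {P : EuclideanSpace ℝ (Fin 3) → ℝ}

/-- **The Bernoulli cap is irrotational.** For `0 < γ < ½` and a `C²` profile with the far-field
bounds (3.8) there is a level `t` with: (i) `t < ℋ(z)` for the Bernoulli-top stagnation point `z`
(`IsMaxOn ℋ univ z`), so the cap `{ℋ > t}` is a nonempty open set; (ii) `curl U = 0` on `{ℋ > t}`.
Proof: the bad stagnation points (`∃ w`, `|w| = 1`, `⟪DU(z) w, w⟫ ≥ 1`) form a compact set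
(continuous image of a closed subset of (stagnation set) × (unit sphere)); their maximal
Bernoulli value `t*` is `< max ℋ` because a bad node at the top level would be a local maximum of
`ℋ`, hence good (`inner_fderiv_le_of_isLocalMax_selfSimilarBernoulli`); above any `t > t*` all
stagnation points are good and the localisation theorem applies. [cite: ConstantinIgnatovaVicol2026Putative, §3.4.3–§3.5 (sharpened and localised; not in print)] -/
theorem exists_irrotational_bernoulliCap (h : IsSelfSimilarEulerProfile γ c U P)
    (hγ : 0 < γ) (hγ2 : γ < 1 / 2) {C : ℝ} (hfar : HasSelfSimilarFarFieldWith γ c C U) :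
    ∃ t : ℝ, (∃ z ∈ selfSimilarNodalSet γ c U, t < selfSimilarBernoulli γ c U P z ∧
        IsMaxOn (selfSimilarBernoulli γ c U P) univ z) ∧
      ∀ y, t < selfSimilarBernoulli γ c U P y → curl U y = 0 := by
  set Hb : EuclideanSpace ℝ (Fin 3) → ℝ := selfSimilarBernoulli γ c U P with hHbdef
  have hU2 : ContDiff ℝ 2 U := h.contDiff_velocity
  have hDUc : Continuous (fderiv ℝ U) := hU2.continuous_fderiv (by norm_num)
  have hHc : Continuous Hb := h.contDiff_selfSimilarBernoulli.continuous
  -- the Bernoulli-top stagnation point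
  obtain ⟨zt, hzt, hmax, -, hgood⟩ := h.exists_bernoulliTop_stagnation hγ hγ2 hfar
  set M : ℝ := Hb zt with hMdef
  have hM : ∀ y, Hb y ≤ M := fun y => hmax (mem_univ y)
  -- the compact set of bad stagnation points
  set N : Set (EuclideanSpace ℝ (Fin 3)) := selfSimilarNodalSet γ c U with hNdef
  have hNc : IsCompact N := hfar.isCompact_selfSimilarNodalSet hγ hU2.continuous
  set S : Set (EuclideanSpace ℝ (Fin 3)) := sphere 0 1 with hSdef
  have hSc : IsCompact S := isCompact_sphere 0 1
  set F : EuclideanSpace ℝ (Fin 3) × EuclideanSpace ℝ (Fin 3) → ℝ :=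
    fun p => ⟪fderiv ℝ U p.1 p.2, p.2⟫ with hFdef
  have hFc : Continuous F := by
    have h1 : Continuous fun p : EuclideanSpace ℝ (Fin 3) × EuclideanSpace ℝ (Fin 3) =>
        fderiv ℝ U p.1 p.2 :=
      (hDUc.comp continuous_fst).clm_apply continuous_snd
    exact h1.inner continuous_snd
  set Bad2 : Set (EuclideanSpace ℝ (Fin 3) × EuclideanSpace ℝ (Fin 3)) :=
    (N ×ˢ S) ∩ {p | 1 ≤ F p} with hBad2
  have hBad2c : IsCompact Bad2 :=
    (hNc.prod hSc).inter_right (isClosed_le continuous_const hFc)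
  set Bad : Set (EuclideanSpace ℝ (Fin 3)) := Prod.fst '' Bad2 with hBad
  have hBadc : IsCompact Bad := hBad2c.image continuous_fst
  -- a node outside `Bad` is good (pointwise)
  have hgood_of : ∀ z ∈ N, z ∉ Bad → ∀ w : EuclideanSpace ℝ (Fin 3), w ≠ 0 →
      ⟪fderiv ℝ U z w, w⟫ < ‖w‖ ^ 2 := by
    intro z hz hzB w hw
    by_contra hle
    have hle' : ‖w‖ ^ 2 ≤ ⟪fderiv ℝ U z w, w⟫ := not_lt.1 hle
    have hn : ‖w‖ ≠ 0 := norm_ne_zero_iff.2 hw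
    set e : EuclideanSpace ℝ (Fin 3) := ‖w‖⁻¹ • w with he
    have he1 : ‖e‖ = 1 := by rw [he, norm_smul, norm_inv, norm_norm, inv_mul_cancel₀ hn]
    have heS : e ∈ S := by simpa [hSdef] using he1
    have hFe : 1 ≤ F (z, e) := by
      simp only [hFdef]
      rw [he, map_smul, inner_smul_left, inner_smul_right, conj_trivial]
      have hpos : 0 < ‖w‖ ^ 2 := pow_pos (norm_pos_iff.2 hw) 2
      rw [← mul_assoc, ← mul_inv, ← sq, inv_mul_eq_div, le_div_iff₀ hpos, one_mul]
      exact hle'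
    exact hzB ⟨(z, e), ⟨⟨hz, heS⟩, hFe⟩, rfl⟩
  -- a bad node is not a local (hence not a global) maximum of `ℋ`: its value is `< M`
  have hBad_lt : ∀ z ∈ Bad, Hb z < M := by
    rintro z ⟨⟨z', w⟩, ⟨⟨hz', hw⟩, hFzw⟩, rfl⟩
    have hw1 : ‖w‖ = 1 := by simpa [hSdef] using hw
    refine lt_of_le_of_ne (hM z') fun hEq => ?_
    -- `z'` would be a global maximum, hence a good node
    have hmax' : IsMaxOn Hb univ z' := fun y _ => by rw [hEq]; exact hM y
    have hloc : IsLocalMax Hb z' := hmax'.isLocalMax univ_mem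
    have hb := h.inner_fderiv_le_of_isLocalMax_selfSimilarBernoulli hγ2 hz' hloc w
    rw [hw1, one_pow, mul_one] at hb
    have hF1 : 1 ≤ ⟪fderiv ℝ U z' w, w⟫ := hFzw
    linarith
  -- the level `t`: the maximal Bernoulli value of a bad node (or anything below `M` if none)
  obtain ⟨t, htM, htBad⟩ : ∃ t : ℝ, t < M ∧ ∀ z ∈ Bad, Hb z ≤ t := by
    rcases Bad.eq_empty_or_nonempty with hempty | hne
    · exact ⟨M - 1, by linarith, fun z hz => by rw [hempty] at hz; exact absurd hz (notMem_empty z)⟩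
    · obtain ⟨zb, hzb, hzbmax⟩ := hBadc.exists_isMaxOn hne hHc.continuousOn
      exact ⟨Hb zb, hBad_lt zb hzb, fun z hz => hzbmax hz⟩
  refine ⟨t, ⟨zt, hzt, htM, hmax⟩, fun y hy => ?_⟩
  -- above `t` every stagnation point is good; apply the localisation at a level in `(t, ℋ y)`
  set t' : ℝ := (t + Hb y) / 2 with ht'
  have ht't : t < t' := by rw [ht']; linarith
  have ht'y : t' < Hb y := by rw [ht']; linarith
  have hnode : ∀ z ∈ selfSimilarNodalSet γ c U, t' ≤ selfSimilarBernoulli γ c U P z →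
      ∀ w : EuclideanSpace ℝ (Fin 3), w ≠ 0 → ⟪fderiv ℝ U z w, w⟫ < ‖w‖ ^ 2 := by
    intro z hz hzt' w hw
    refine hgood_of z hz (fun hzB => ?_) w hw
    have := htBad z hzB
    have : (Hb z : ℝ) = selfSimilarBernoulli γ c U P z := rfl
    linarith
  exact h.curl_eq_zero_on_bernoulliSuperlevel_of_hasSelfSimilarFarField hγ hγ2 hfar t' hnode y ht'y

end IsSelfSimilarEulerProfile

end Literature.Analysis.FluidPDE

end
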